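import Literature.AlgebraicGeometry.Motives.Cycles
import Literature.AlgebraicGeometry.Motives.CyclesDimensionProofs
import Literature.AlgebraicGeometry.Dimension.PointDimension
import HarnessLib

/-!
# Discharged fact: principal divisors on a `(d+1)`-dimensional subvariety are `d`-cycles

`Literature.AlgebraicGeometry.Motives.Cycles` records as a named fact
(`Literature.divFun_mem_cyclesOfDim : Prop`) that on a scheme `X` locally of finite type over a field
`k`, for a closed subvariety `W ↪ X` of dimension `d + 1` and a nonzero rational function
`f ∈ K(W)`, every cycle whose coefficient function is `W.divFun f` (Mathlib's order of vanishing
`Scheme.ord f` on `W`, extended by zero) is a `d`-cycle, i.e. is supported on points `z` with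
`Order.height z = d` (`dim closure {z} = d`). This file proves it
(`Literature.AlgebraicGeometry.Motives.divFun_mem_cyclesOfDim_holds`), sorry-free.

The mathematical content is the dimension theory of locally algebraic schemes over a field,
Stacks Project, Varieties, Lemma 0A21: for `X` locally of finite type over a field `k`,
(3) if `X` is irreducible then `dim X = dim_x X` for every `x ∈ X`, (6) `dim X = trdeg_k κ(η)`
for `X` irreducible with generic point `η`, and (10) `dim_x X = trdeg_k κ(x) + dim 𝒪_{X,x}`;
hence on an integral `X`, `dim closure {x} + dim 𝒪_{X,x} = dim X` for every point `x`
(equivalently the dimension formula, Morphisms, Lemma 02JU, over the universally catenary base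
`Spec k`; Hartshorne II Ex. 3.20 (d); Görtz–Wedhorn I, Prop. 5.30 (2)). In the order-theoretic
language of Mathlib's schemes (`a ≤ b ↔ b ⤳ a`, `Order.height x = dim closure {x}`,
`Order.coheight x = dim 𝒪_{X,x}`, the generic point is `⊤`) this reads
`height x + coheight x = height ⊤` (`Literature.AlgebraicGeometry.Motives.Scheme.height_add_coheight_eq_height_top`).

## Proof

Following the printed proof of 0A21 ("reduce to the affine case"): for `y` in an affine open
`U = Spec A` of `Y` (locally of finite type over `K`, `A` a domain), with `𝔭 = 𝔭_U(y) ⊂ A`,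
* `height y = dim A ⧸ 𝔭` is the chart formula
  `Literature.AlgebraicGeometry.Dimension.Scheme.height_eq_ringKrullDim_quotient_primeIdealOf`
  (`Literature/AlgebraicGeometry/Dimension/PointDimension.lean`, Görtz–Wedhorn I Thm. 5.22),
  and `dim A ⧸ 𝔭 = coheight 𝔭` in `Spec A`;
* `coheight y = dim 𝒪_{Y,y} = height 𝔭` (Mathlib `coheight_eq_of_isOpenImmersion`,
  `idealHeight_eq_coheight`);
* `height 𝔭 + coheight 𝔭 = dim A` is the dimension formula for affine domains
  `Literature.AlgebraicGeometry.Motives.height_add_coheight_eq_of_isDomain` (Hartshorne I Thm. 1.8A (b),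
  `Literature/AlgebraicGeometry/Motives/CyclesDimensionProofs.lean`);
so `height y + coheight y = dim A` for all `y ∈ U` (`Literature.AlgebraicGeometry.Motives.Scheme.height_add_coheight_eq_of_mem`),
in particular for the generic point `⊤ ∈ U`, whose coheight is `0`.

For the discharge: a point `z` with `divFun f z ≠ 0` is `ι w` for a point `w ∈ W` with
`Scheme.ord f w ≠ 0`, hence `coheight w = 1` (Mathlib's `Scheme.ord` vanishes off codimension
one); the closed immersion `ι` preserves heights (`Literature.AlgebraicGeometry.Motives.ClosedSubvariety.height_ι_base`: closed
embeddings are order embeddings with down-closed image), so `height ⊤ = dim W = d + 1` on `W`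
and `height z = height w = d`.

## Main results

* `Literature.AlgebraicGeometry.Motives.ClosedSubvariety.height_ι_base`, `Literature.AlgebraicGeometry.Motives.ClosedSubvariety.dim_eq_height_top`: the dimension
  of point closures, and of `W`, is the same computed in `W` or in the ambient `X`.
* `Literature.AlgebraicGeometry.Motives.Scheme.height_add_coheight_eq_of_mem`: `height y + coheight y = dim Γ(Y, U)` for `y` in
  an affine open `U` with `Γ(Y, U)` a domain, `Y` locally of finite type over a field.
* `Literature.AlgebraicGeometry.Motives.Scheme.height_add_coheight_eq_height_top`: Stacks 0A21 (3)+(10) for integral `Y`.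
* `Literature.divFun_mem_cyclesOfDim_holds : Literature.divFun_mem_cyclesOfDim`.

## References

* [StacksProject] The Stacks Project, Tag 0A21 (Varieties, Lemma "dimension-locally-algebraic",
  items (3), (6), (10)), Tag 02JU (Morphisms, the dimension formula), Tags 02QQ, 02S0 (Chow
  homology: cycles, rational equivalence).
* W. Fulton, *Intersection Theory*, 2nd ed. (1998), §1.2–1.3 (`[div(r)]` is a `k`-cycle for
  `r ∈ R(W)^*`, `W` a `(k+1)`-dimensional subvariety).
* R. Hartshorne, *Algebraic Geometry* (1977), I Thm. 1.8A (b), II Ex. 3.20 (d).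
-/

universe u

open CategoryTheory AlgebraicGeometry Order Topology TopologicalSpace

namespace Literature.AlgebraicGeometry.Motives

/-! ### The dimension of a closed subvariety is intrinsic -/

namespace ClosedSubvariety

variable {X : Scheme.{u}} (W : ClosedSubvariety X)

/-- For a closed subvariety `W ↪ X` and a point `w` of `W`, the dimension of the closure of `w`
is the same computed in `W` or in `X`: `Order.height (ι w) = Order.height w` (the closed
immersion `ι` is an order embedding for the specialisation orders, being a topological
embedding, and strict specialisations of `ι w` in `X` stay in the closed subset `ι(W)`,
`Literature.AlgebraicGeometry.Motives.exists_lt_base_eq_of_isClosedMap`, so Mathlib's `Order.height_eq_of_strictMono` applies).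
This is the case `f = W.ι` of `Literature.AlgebraicGeometry.Motives.Scheme.height_base_eq_of_isClosedImmersion`
(`Literature/AlgebraicGeometry/Motives/BettiCycleClassProofs.lean`), re-proved here in five
lines to keep the imports of this file inside the dimension theory of cycles. [folklore] -/
theorem height_ι_base (w : W.carrier) : height (W.ι.base w) = height w := by
  refine (height_eq_of_strictMono (fun a : W.carrier => W.ι.base a) (fun a b hab ↦ ?_)
    (fun _ _ hb ↦ exists_lt_base_eq_of_isClosedMap W.ι W.ι.isClosedEmbedding.isClosedMap hb)
    w).symm
  simp only [lt_iff_le_not_ge, Scheme.le_iff_specializes] at hab ⊢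
  rwa [W.ι.isClosedEmbedding.isInducing.specializes_iff,
    W.ι.isClosedEmbedding.isInducing.specializes_iff]

/-- The dimension `W.dim` of a closed subvariety (the height of its generic point in the
specialisation order of the ambient scheme `X`) is the height of the generic point `⊤` of `W` in
`W` itself, i.e. the Krull dimension of the integral scheme `W`. [folklore] -/
theorem dim_eq_height_top : W.dim = height (⊤ : W.carrier) :=
  W.height_ι_base ⊤

end ClosedSubvariety

/-! ### The dimension formula on schemes locally of finite type over a field (Stacks 0A21) -/

section DimensionFormula

variable {K : Type u} [Field K] {Y : Scheme.{u}} (f : Y ⟶ Spec (CommRingCat.of K))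

/-- The sections over an affine open of a scheme locally of finite type over a field `K` form a
finitely generated `K`-algebra (for the algebra structure through `K = Γ(Spec K) → Γ(Y, U)`).
[folklore] -/
lemma Scheme.exists_algebra_finiteType [LocallyOfFiniteType f] {U : Y.Opens}
    (hU : IsAffineOpen U) : ∃ _ : Algebra K Γ(Y, U), Algebra.FiniteType K Γ(Y, U) := by
  let ι : K →+* Γ(Spec (CommRingCat.of K), ⊤) := (Scheme.ΓSpecIso (CommRingCat.of K)).inv.hom
  let φ : K →+* Γ(Y, U) := (f.appLE ⊤ U le_top).hom.comp ι
  letI : Algebra K Γ(Y, U) := φ.toAlgebra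
  refine ⟨φ.toAlgebra, ?_⟩
  have h1 : (f.appLE ⊤ U le_top).hom.FiniteType :=
    f.finiteType_appLE (isAffineOpen_top _) hU le_top
  have h2 : ι.FiniteType :=
    RingHom.FiniteType.of_surjective _
      (Scheme.ΓSpecIso (CommRingCat.of K)).symm.commRingCatIsoToRingEquiv.surjective
  exact h1.comp h2

/-- **Stacks 0A21 (10) in an affine chart.** Let `Y` be locally of finite type over a field `K`
and `U ⊆ Y` an affine open whose coordinate ring `A = Γ(Y, U)` is a domain, of dimension `n`.
Then every `y ∈ U` satisfies `height y + coheight y = n`, i.e.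
`dim closure {y} + dim 𝒪_{Y,y} = dim A`: with `𝔭 = 𝔭_U(y)`, `height y = dim A ⧸ 𝔭 = coheight 𝔭`
(chart formula, Görtz–Wedhorn I Thm. 5.22), `coheight y = height 𝔭` (Mathlib
`coheight_eq_of_isOpenImmersion`, `idealHeight_eq_coheight`), and
`height 𝔭 + coheight 𝔭 = dim A` in the affine domain `A` (Hartshorne I Thm. 1.8A (b),
`Literature.AlgebraicGeometry.Motives.height_add_coheight_eq_of_isDomain`). [cite: StacksProject, Tag 0A21 (3), (6), (10)] -/
theorem Scheme.height_add_coheight_eq_of_mem [LocallyOfFiniteType f] {U : Y.Opens}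
    (hU : IsAffineOpen U) [IsDomain Γ(Y, U)] {n : ℕ} (hn : ringKrullDim Γ(Y, U) = n)
    {y : Y} (hy : y ∈ U) : height y + coheight y = n := by
  obtain ⟨alg, hft⟩ := Scheme.exists_algebra_finiteType f hU
  set x : PrimeSpectrum Γ(Y, U) := hU.primeIdealOf ⟨y, hy⟩ with hx
  -- `height y = coheight 𝔭`
  have h1 : height y = coheight x := by
    have h := Dimension.Scheme.height_eq_ringKrullDim_quotient_primeIdealOf f hU hy
    rw [← Dimension.PrimeSpectrum.coe_coheight_eq_ringKrullDim_quotient] at h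
    exact_mod_cast h
  -- `coheight y = height 𝔭`
  have h2 : coheight y = height x := by
    have e1 : coheight y = coheight (hU.fromSpec.base x) := by rw [hx, hU.fromSpec_primeIdealOf]
    rw [e1, coheight_eq_of_isOpenImmersion, ← idealHeight_eq_coheight,
      PrimeSpectrum.height_eq_orderHeight]
  have h := height_add_coheight_eq_of_isDomain K n Γ(Y, U) hn x
  rw [h1, h2, add_comm]
  exact h

/-- **Stacks 0A21 (3) with (6) and (10): `dim closure {y} + dim 𝒪_{Y,y} = dim Y` on an integral
scheme locally of finite type over a field.** For `Y` integral and locally of finite type over a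
field `K` and any point `y`, `height y + coheight y = height ⊤` in the specialisation order,
where `⊤` is the generic point (so `height ⊤ = dim Y`): both `y` and `⊤` lie in a common affine
chart `Spec A`, where `height + coheight = dim A` (`height_add_coheight_eq_of_mem`) and
`coheight ⊤ = 0`. (Hartshorne II Ex. 3.20 (d); Görtz–Wedhorn I Prop. 5.30 (2).)
[cite: StacksProject, Tag 0A21 (3), (6), (10)] -/
theorem Scheme.height_add_coheight_eq_height_top [IsIntegral Y] [LocallyOfFiniteType f]
    (y : Y) : height y + coheight y = height (⊤ : Y) := by
  obtain ⟨_, ⟨U, hU, rfl⟩, hyU, -⟩ :=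
    Y.isBasis_affineOpens.exists_subset_of_mem_open (Set.mem_univ y) isOpen_univ
  have hU : IsAffineOpen U := hU
  haveI : Nonempty U := ⟨⟨y, hyU⟩⟩
  have htop : (⊤ : Y) ∈ U :=
    (AlgebraicGeometry.Scheme.le_iff_specializes.mp (le_top (a := y))).mem_open U.2 hyU
  obtain ⟨alg, hft⟩ := Scheme.exists_algebra_finiteType f hU
  obtain ⟨n, hn⟩ := exists_ringKrullDim_eq_natCast K Γ(Y, U)
  have h1 := Scheme.height_add_coheight_eq_of_mem f hU hn hyU
  have h2 := Scheme.height_add_coheight_eq_of_mem f hU hn htop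
  rw [Order.coheight_top, add_zero] at h2
  rw [h1, h2]

/-- Numerical form of `height_add_coheight_eq_height_top`: on an integral scheme locally of
finite type over a field with `height ⊤ = m` (`dim Y = m`), a point of codimension `p`
(`coheight y = p`) has dimension `m - p`, stated additively.
[cite: StacksProject, Tag 0A21 (3), (6), (10)] -/
theorem Scheme.height_eq_of_coheight_eq [IsIntegral Y] [LocallyOfFiniteType f] {y : Y}
    {m p e : ℕ} (hm : height (⊤ : Y) = m) (hp : coheight y = p) (he : e + p = m) :
    height y = e := by
  have h := Scheme.height_add_coheight_eq_height_top f y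
  rw [hp, hm, ← he, Nat.cast_add] at h
  exact WithTop.add_right_cancel (ENat.coe_ne_top p) h

end DimensionFormula

/-! ### Discharge of `Literature.AlgebraicGeometry.Motives.divFun_mem_cyclesOfDim` -/

/-- **Discharge of the named fact `Literature.AlgebraicGeometry.Motives.divFun_mem_cyclesOfDim`**: on a scheme `X` locally of
finite type over a field `k`, for a closed subvariety `W ↪ X` of dimension `d + 1` and
`f ∈ K(W)ˣ`, `div f` is a `d`-cycle (Fulton, *Intersection Theory* §1.3: `[div(r)]` is a
`k`-cycle for `W` a `(k+1)`-dimensional subvariety; Stacks 02S0 over `(Spec k, δ = trdeg)`).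
A point `z` with `divFun f z ≠ 0` is `ι w` with `Scheme.ord f w ≠ 0`, so `w` has codimension
one in `W` (`Scheme.ord_eq_zero_of_coheight_neq_one`); `W` is integral and locally of finite
type over `k` (through `ι ≫ (X → Spec k)`), so `height w + 1 = height ⊤ = dim W = d + 1`
(`Scheme.height_add_coheight_eq_height_top`, Stacks 0A21), and the closed immersion `ι`
preserves heights (`ClosedSubvariety.height_ι_base`).
[cite: StacksProject, Tag 0A21 (3), (6), (10)] -/
theorem divFun_mem_cyclesOfDim_holds : divFun_mem_cyclesOfDim.{u} := by
  intro k _ X _ W _ d f hW hf c hc z hz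
  have hz' : W.divFun f z ≠ 0 := by rwa [← hc]
  -- `z` lies on `W`
  obtain ⟨w, rfl⟩ : z ∈ Set.range W.ι.base := by
    by_contra h
    exact hz' (W.divFun_of_notMem_range f h)
  -- `w` has codimension one in `W`
  rw [W.divFun_ι_base] at hz'
  have hw : coheight w = 1 := by
    by_contra h
    exact hz' (Scheme.ord_eq_zero_of_coheight_neq_one h f)
  -- `dim W = d + 1`, read on `W` through the closed immersion `ι`
  have htop : height (⊤ : W.carrier) = (d + 1 : ℕ) := by
    rw [← W.dim_eq_height_top, hW]
    push_cast
    rfl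
  -- dimension theory on the integral scheme `W`, locally of finite type over `k`
  haveI : LocallyOfFiniteType (W.ι ≫ X.hom) := inferInstance
  rw [W.height_ι_base w]
  exact Scheme.height_eq_of_coheight_eq (W.ι ≫ X.hom) htop hw rfl

end Literature.AlgebraicGeometry.Motives
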